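import Summits.BirchSwinnertonDyer.Rank1Residual.X11b.BDPRouteUpperLinksFieldAll
import Literature.NumberTheory.EllipticCurves.NonvanishingTwistsPrescribedInert
import Literature.NumberTheory.QuadraticFields.KroneckerSplitting
import Literature.NumberTheory.QuadraticFields.HeegnerCondition
import HarnessLib

/-!
# Class X11b, route "BDP + converse-theorem engine + Kolyvagin": (T2) reduced to the sub-shape (T2α) plus the two Shimura-curve displays — the auxiliary field of JSW §7.4.2 CONSTRUCTED from Friedberg–Hoffstein (cell `b2b-bsdres`, sub-cell `multr1-p2`, gen 9)

HONEST FRAMING (verbatim, cell `b2b-bsdres`): the goal of the cell is to DELETE the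
COMBINATION-SHAPED residual classes for ALL analytic-rank `≤ 1` curves over `ℚ` — "full BSD
formula for every rank `≤ 1` curve in class `C`" assembled STRICTLY from published theorems — so
that the rank-`≤ 1` remainder becomes exactly the CONSTRUCTION-SHAPED classes, which are TYPED
(missing-input Props), NOT attempted; this is not "finishing BSD". Research route `p2` for class
X11b; no claim beyond the stated class; nothing booked; X11b stays CONSTRUCTION-SHAPED. Theorems
only (no definition, no new named fact here; the Friedberg–Hoffstein special case is the tree's
named fact `friedbergHoffstein_exists_twist_ne_zero_inertAt`,
`Literature/NumberTheory/EllipticCurves/NonvanishingTwistsPrescribedInert.lean`, a PUBLISHED input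
like the other binders).

## What this file does

For an X11b pair `(E,p)` (`p ≥ 5`) with a (ram) prime and NOT of the sub-shape (T2α) (i.e. not
"split multiplicative and peu ramifié at `p`"), this file CONSTRUCTS the data of
`missingUpperBoundAt_of_classX11b_of_shimuraShapes_inertSet'` (`BDPRouteUpperLinksFieldAll.lean`):
the inert set `S` = the offending primes `ℓ ≠ p` (split multiplicative with `p ∣ ord_ℓ Δ_min`),
padded to EVEN cardinality with the (ram) witness; the field `K″` from the Friedberg–Hoffstein
special case of Jetchev–Skinner–Wan 2017 §7.4.2 (`S` inert, the other bad primes split,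
`L(E^{d_K},1) ≠ 0`; sign `+1` because `w(E) = −1` and (H)); the conversion of the splitting data
(`#primes above ℓ`) into the local forms used by the bookkeeping (`(d_K/ℓ) = −1`, `d_K ≡ 5 mod 8`,
`d_K ∈ ℚ_ℓ^{×2}` — `KroneckerSplitting`); and a globally minimal model of the twist. RESULT:

* `missingUpperBoundAt_of_classX11b_of_ram_of_not_alpha` — on X11b ∧ `p ≥ 5` ∧ (ram) ∧ ¬(T2α):
  `Typed.MissingUpperBoundAt E p` ⇐ PUBLISHED (`hSk` Skinner 2016 Thm. C, `hGZK`, `hmod`, `hnf`,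
  `hFH` = Friedberg–Hoffstein 1995 Thm. B in JSW's special case) + ONE typed input (T2♯): "at
  every such field the CM point carries (U-Sh) and (GZ-Sh)" — displayed as `∃ P ∈ E(K)` with the two shapes (its discharge = JSW Thm. 4.4.1 + explicit
  Gross–Zagier on `X_{N⁺,N⁻}` at the point `z_K^{N⁺,N⁻}`, SPEC §5);
* `bsdp_of_classX11b_five_of_typedInputs_shimura` — the whole-class theorem of gen 8 with (T2)
  replaced by (T2α′) `MissingUpperBoundAt` on the pairs with `p ∣ ∏c` that are ¬(ram) or (T2α)
  [census 2 132 + 20 824 of 64 130] and (T2♯) on the rest [41 174].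

CONDITIONAL; nothing booked; labels unchanged.

References: [JetchevSkinnerWan2017] §7.4.2 (p. 31), §4.1 (p. 17), Thm. 4.4.1 (p. 19);
[FriedbergHoffstein1995] Thm. B; [Skinner2016PacificMC] Thm. C; [Miller2011LMS] Def. 1.1.
-/

noncomputable section

open scoped Classical

open WeierstrassCurve NumberField IsDedekindDomain Literature.NumberTheory.EllipticCurves
  Rat.HeightOneSpectrum
  Literature.NumberTheory.EllipticCurves.ModularForms
  Literature.NumberTheory.EllipticCurves.Rank1Residual
  Literature.NumberTheory.EllipticCurves.Rank1Residual.Typed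
  Literature.NumberTheory.EllipticCurves.Wuthrich2014
  Literature.NumberTheory.EllipticCurves.BalakrishnanEtAl2019
  Literature.NumberTheory.QuadraticFields.Quadratic

namespace Summit.BirchSwinnertonDyer.Rank1Residual.X11b

/-! ### Splitting data of a quadratic field in local form -/

section Bridges

variable {K : Type} [Field K] [NumberField K] (h2 : Module.finrank ℚ K = 2)
include h2

/-- A prime with two primes of `𝓞_K` above it (split) has `d_K ∈ ℚ_ℓ^{×2}`: `(d_K/ℓ) = 1` and
Hensel for odd `ℓ`, `d_K ≡ 1 (mod 8)` for `ℓ = 2` (Marcus Ch. 3 Thm. 25; Serre II.3.3).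
[cite: Serre1973, Ch. II §3.3 Thms 3–4] -/
theorem isSquare_discr_padic_of_ncard_eq_two (ℓ : ℕ) [Fact ℓ.Prime]
    (h : ((Ideal.span {(ℓ : ℤ)}).primesOver (𝓞 K)).ncard = 2) :
    IsSquare (algebraMap ℚ ℚ_[ℓ] (NumberField.discr K : ℚ)) := by
  have hℓ : ℓ.Prime := Fact.out
  by_cases hℓ2 : ℓ = 2
  · subst hℓ2
    have h8 := (ncard_primesOver_two_eq_two_iff h2).mp h
    have := Literature.NumberTheory.QuadraticForms.padic_isSquare_intCast_of_mod_eight (p := 2) rfl h8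
    simpa using this
  · have hJ := (ncard_primesOver_eq_two_iff_jacobiSym h2 hℓ hℓ2).mp h
    have := padic_isSquare_of_jacobiSym_eq_one (q := ℓ) hℓ2 hJ
    simpa using this

/-- An odd prime `ℓ ∤ d_K` which is not split is inert: `(d_K/ℓ) = −1`. [folklore] -/
theorem jacobiSym_discr_eq_neg_one_of_ncard_ne_two {ℓ : ℕ} (hℓ : ℓ.Prime) (hℓ2 : ℓ ≠ 2)
    (hn : ((Ideal.span {(ℓ : ℤ)}).primesOver (𝓞 K)).ncard ≠ 2)
    (hd : ¬ (ℓ : ℤ) ∣ NumberField.discr K) : jacobiSym (NumberField.discr K) ℓ = -1 := by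
  have hgcd : (NumberField.discr K).gcd ℓ = 1 := by
    have hnd : ¬ ℓ ∣ (NumberField.discr K).natAbs := fun h ↦ hd (Int.natCast_dvd.mpr h)
    have hc : Nat.Coprime (NumberField.discr K).natAbs ℓ := ((Nat.Prime.coprime_iff_not_dvd hℓ).mpr hnd).symm
    exact hc
  rcases jacobiSym.eq_one_or_neg_one hgcd with h1 | h1
  · exact absurd ((ncard_primesOver_eq_two_iff_jacobiSym h2 hℓ hℓ2).mpr h1) hn
  · exact h1

/-- `2 ∤ d_K` not split means `2` inert: `d_K ≡ 5 (mod 8)` (Stickelberger `d_K ≡ 1 mod 4` for odd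
`d_K`, and `2` splits iff `d_K ≡ 1 mod 8`). [folklore] -/
theorem discr_emod_eight_eq_five_of_ncard_ne_two
    (hn : ((Ideal.span {(2 : ℤ)}).primesOver (𝓞 K)).ncard ≠ 2)
    (hd : ¬ (2 : ℤ) ∣ NumberField.discr K) : NumberField.discr K % 8 = 5 := by
  have h4 := discr_emod_four h2
  have h81 : NumberField.discr K % 8 ≠ 1 := fun h ↦ hn ((ncard_primesOver_two_eq_two_iff h2).mpr h)
  omega

end Bridges

/-! ### (T2) off (T2α): the field of JSW §7.4.2 constructed, the two shapes left -/

/-- **X11b ∧ `p ≥ 5` ∧ (ram) ∧ ¬(T2α): the Euler-system half from the two Shimura-curve displays.**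
PUBLISHED inputs: `hSk` (Skinner 2016 Thm. C), `hGZK`, `hmod`, `hnf` (modularity: the sign is
`(−1)^{r_an}`), and `hFH` = Friedberg–Hoffstein 1995 Thm. B in the special case of
Jetchev–Skinner–Wan 2017 §7.4.2 (p. 31: "`S` inert, the other primes of `N` split, `L(E^{D″},1) ≠ 0`";
displayed in the shape of the named fact `friedbergHoffstein_exists_twist_ne_zero_inertAt`). TYPED
input (T2♯): for every X11b pair, every finite set `S` of multiplicative primes, of even
cardinality (hypothesis (H) of JSW §4.1), inert in an imaginary quadratic `K` with the other bad primes split and the split-multiplicative primes outside `S` très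
ramifié, and every globally minimal model of `E^{d_K}` with `L(E^{d_K},1) ≠ 0`, SOME point
`P ∈ E(K)` carries (U-Sh) and (GZ-Sh) with `T = Σ_{ℓ∈S} ord_p(ord_ℓ Δ_min(E))` — in print the CM
point `z_K^{N⁺,N⁻}` by JSW Thm. 4.4.1 and the explicit Gross–Zagier formula on `X_{N⁺,N⁻}`. The
proof CONSTRUCTS `S` (the offending primes `ℓ ≠ p`, padded to even size with the (ram) witness) and
the field. CONCLUSION: `Typed.MissingUpperBoundAt W p` for every X11b pair with `p ≥ 5`, a (ram)
prime, and not both `E` split multiplicative at `p` and `p ∣ ord_p Δ_min` (census: 41 174 ‖ 1 372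
of the 61 998 ‖ 2 149 pairs of the (ram) ∧ `p ∣ ∏c` atom; on the Locus `p ∤ ∏c` the conclusion is
already unconditional, `missingUpperBoundAt_of_classX11b_of_locus`). CONDITIONAL on (T2♯);
nothing booked; X11b stays CONSTRUCTION-SHAPED.
[cite: JetchevSkinnerWan2017, §7.4.2 (p. 31), §4.1 (p. 17), Thm. 4.4.1 (p. 19)]
[cite: FriedbergHoffstein1995, Thm. B] [cite: Skinner2016PacificMC, Thm. C (§1) and footnote 1]
[cite: Miller2011LMS, Def. 1.1] -/
theorem missingUpperBoundAt_of_classX11b_of_ram_of_not_alpha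
    -- published inputs (named facts of the tree)
    (hSk : Skinner2016.thmC_padicValRat_bsd_rank_zero)
    (hGZK : rank_eq_analyticRank_of_analyticRank_le_one) (hmod : hasEntireLFunction_rat)
    (hnf : exists_isNewformOf)
    -- Friedberg–Hoffstein 1995 Thm. B, the special case of JSW §7.4.2 (named fact of the tree)
    (hFH : friedbergHoffstein_exists_twist_ne_zero_inertAt)
    -- (T2♯) the two Shimura-curve shapes at every JSW field
    (hSh : ∀ (W : WeierstrassCurve ℚ) [W.IsElliptic] [W.IsGloballyMinimal] (p : ℕ) [Fact p.Prime]
      (K : Type) [Field K] [NumberField K] (S : Finset ℕ)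
      (Wd : WeierstrassCurve ℚ) [Wd.IsElliptic] [Wd.IsGloballyMinimal] (Cd : VariableChange ℚ),
      ClassX11b W p → 5 ≤ p → IsImaginaryQuadratic K → Even S.card →
      (∀ ℓ ∈ S, ∃ _ : Fact ℓ.Prime, Mult W ℓ ∧
        ((ℓ ≠ 2 ∧ jacobiSym (NumberField.discr K) ℓ = -1) ∨ (ℓ = 2 ∧ NumberField.discr K % 8 = 5))) →
      (∀ (ℓ : ℕ) [Fact ℓ.Prime], ¬ W.HasGoodReductionAtPrime ℓ → ℓ ∉ S →
        IsSquare (algebraMap ℚ ℚ_[ℓ] (NumberField.discr K : ℚ))) →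
      (∀ (ℓ : ℕ) [Fact ℓ.Prime], ℓ ∉ S → W.HasSplitMultiplicativeReductionAtPrime ℓ →
        ¬ p ∣ padicValInt ℓ W.minimalDiscriminantInt) →
      Cd • W.quadraticTwist (NumberField.discr K : ℚ) = Wd →
      (W.quadraticTwist (NumberField.discr K : ℚ)).entireLFunction 1 ≠ 0 →
      ∃ P : (W.baseChange K).toAffine.Point,
        (∃ qE qd : ℚ, qE ≠ 0 ∧ qd ≠ 0 ∧
          W.leadingLCoeff / ((W.realPeriodRat : ℂ) * (W.regulator : ℂ)) = (qE : ℂ) ∧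
          Wd.entireLFunction 1 / (Wd.realPeriodRat : ℂ) = (qd : ℂ) ∧
          (2 * padicValNat p (AddSubgroup.zmultiples P).index : ℤ) +
              (∑ ℓ ∈ S, padicValNat p (padicValInt ℓ W.minimalDiscriminantInt) : ℕ) =
            padicValRat p qE + padicValRat p qd) ∧
        Nat.card (AddCommGroup.primaryComponent (W.baseChange K).sha p) ≤
          p ^ (2 * padicValNat p (AddSubgroup.zmultiples P).index)) :
    ∀ (W : WeierstrassCurve ℚ) [W.IsElliptic] [W.IsGloballyMinimal] (p : ℕ) [Fact p.Prime],
      ClassX11b W p → 5 ≤ p → Ram W p →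
      ¬ (W.HasSplitMultiplicativeReductionAtPrime p ∧ p ∣ padicValInt p W.minimalDiscriminantInt) →
      Typed.MissingUpperBoundAt W p := by
  intro W _ _ p _ hX hp5 hram hα
  have hp : p.Prime := Fact.out
  obtain ⟨hr, -, hmult, hirr⟩ := id hX
  -- the sign of the functional equation is `−1` (modularity, `r_an = 1`)
  have hw : W.rootNumber = -1 := by
    rw [WeierstrassCurve.rootNumber_eq_neg_one_pow_analyticRank_of_exists_isNewformOf hnf W, hr]
    norm_num
  have hN0 : W.conductorNorm ℤ ≠ 0 := (W.conductorNorm_pos_holds).ne'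
  -- the (ram) witness
  obtain ⟨ℓ₀, hℓ₀F, hℓ₀p, hmult₀, hram₀⟩ := hram
  -- the offending primes `ℓ ≠ p`
  set S₀ : Finset ℕ := (W.conductorNorm ℤ).primeFactors.filter (fun ℓ ↦ ℓ ≠ p ∧ ∃ h : ℓ.Prime,
      @WeierstrassCurve.HasSplitMultiplicativeReductionAtPrime W ℓ ⟨h⟩ ∧
        p ∣ padicValInt ℓ W.minimalDiscriminantInt) with hS₀
  have hℓ₀S₀ : ℓ₀ ∉ S₀ := by
    intro h
    obtain ⟨-, -, _, -, hdvd⟩ := (Finset.mem_filter.mp h)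
    exact hram₀ hdvd
  -- pad to even cardinality with the (ram) witness
  set S : Finset ℕ := if Even S₀.card then S₀ else insert ℓ₀ S₀ with hS
  have hS₀S : S₀ ⊆ S := by
    rw [hS]; split_ifs
    · exact le_rfl
    · exact Finset.subset_insert _ _
  have hmemS : ∀ ℓ ∈ S, ℓ ∈ S₀ ∨ ℓ = ℓ₀ := by
    intro ℓ hℓ; rw [hS] at hℓ; split_ifs at hℓ
    · exact Or.inl hℓ
    · rcases Finset.mem_insert.mp hℓ with h | h
      · exact Or.inr h
      · exact Or.inl h
  have hSeven : Even S.card := by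
    rw [hS]; split_ifs with he
    · exact he
    · rw [Finset.card_insert_of_notMem hℓ₀S₀]; exact Nat.even_add_one.mpr he
  have hSmult : ∀ ℓ ∈ S, ∃ _ : Fact ℓ.Prime, W.HasMultiplicativeReductionAtPrime ℓ := by
    intro ℓ hℓ
    rcases hmemS ℓ hℓ with h | rfl
    · obtain ⟨-, -, hℓp, hs, -⟩ := Finset.mem_filter.mp h
      haveI : Fact ℓ.Prime := ⟨hℓp⟩
      exact ⟨inferInstance, hs.hasMultiplicativeReductionAtPrime⟩
    · exact ⟨hℓ₀F, hmult₀⟩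
  have hpS : p ∉ S := by
    intro h
    rcases hmemS p h with h' | h'
    · exact (Finset.mem_filter.mp h').2.1 rfl
    · exact hℓ₀p h'.symm
  have hFC : ∀ (ℓ : ℕ) [Fact ℓ.Prime], ℓ ∉ S → W.HasSplitMultiplicativeReductionAtPrime ℓ →
      ¬ p ∣ padicValInt ℓ W.minimalDiscriminantInt := by
    intro ℓ hℓF hℓS hs hdvd
    by_cases hℓp : ℓ = p
    · subst hℓp; exact hα ⟨hs, hdvd⟩
    · apply hℓS; apply hS₀S
      have hℓN : ℓ ∣ W.conductorNorm ℤ :=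
        (W.dvd_conductorNorm_iff_not_hasGoodReductionAtPrime ℓ).mpr
          (WeierstrassCurve.HasMultiplicativeReduction.not_hasGoodReduction (R := ℤ_[ℓ])
            hs.hasMultiplicativeReductionAtPrime)
      exact Finset.mem_filter.mpr ⟨Nat.mem_primeFactors.mpr ⟨hℓF.out, hℓN, hN0⟩, hℓp, hℓF.out, hs, hdvd⟩
  -- the field of JSW §7.4.2 (Friedberg–Hoffstein)
  obtain ⟨K, _, _, hK, -, hinert, hsplitN, hLt⟩ := hFH W hw S hSmult hSeven 0
  have h2 := hK.1
  have hSin : ∀ ℓ ∈ S, ∃ _ : Fact ℓ.Prime, Mult W ℓ ∧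
      ((ℓ ≠ 2 ∧ jacobiSym (NumberField.discr K) ℓ = -1) ∨ (ℓ = 2 ∧ NumberField.discr K % 8 = 5)) := by
    intro ℓ hℓ
    obtain ⟨hℓF, hm⟩ := hSmult ℓ hℓ
    obtain ⟨hn, hd⟩ := hinert ℓ hℓ
    refine ⟨hℓF, hm, ?_⟩
    have hn' : ((Ideal.span {(ℓ : ℤ)}).primesOver (𝓞 K)).ncard ≠ 2 := by rw [hn]; decide
    by_cases hℓ2 : ℓ = 2
    · subst hℓ2
      have hn2 : ((Ideal.span {(2 : ℤ)}).primesOver (𝓞 K)).ncard ≠ 2 := by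
        simpa only [Nat.cast_ofNat] using hn'
      have hd2 : ¬ (2 : ℤ) ∣ NumberField.discr K := by simpa only [Nat.cast_ofNat] using hd
      exact Or.inr ⟨rfl, discr_emod_eight_eq_five_of_ncard_ne_two h2 hn2 hd2⟩
    · exact Or.inl ⟨hℓ2, jacobiSym_discr_eq_neg_one_of_ncard_ne_two h2 hℓF.out hℓ2 hn' hd⟩
  have hsplit : ∀ (ℓ : ℕ) [Fact ℓ.Prime], ¬ W.HasGoodReductionAtPrime ℓ → ℓ ∉ S →
      IsSquare (algebraMap ℚ ℚ_[ℓ] (NumberField.discr K : ℚ)) := by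
    intro ℓ hℓF hg hℓS
    have hℓN : ℓ ∣ W.conductorNorm ℤ := (W.dvd_conductorNorm_iff_not_hasGoodReductionAtPrime ℓ).mpr hg
    exact isSquare_discr_padic_of_ncard_eq_two h2 ℓ (hsplitN ℓ hℓF.out hℓN hℓS)
  -- a globally minimal model of the twist
  have hD0 : (NumberField.discr K : ℚ) ≠ 0 := by exact_mod_cast NumberField.discr_ne_zero K
  haveI hEt : (W.quadraticTwist (NumberField.discr K : ℚ)).IsElliptic :=
    W.isElliptic_quadraticTwist hD0
  obtain ⟨Cd, hCd⟩ := hasGlobalMinimalModel_rat_holds (W.quadraticTwist (NumberField.discr K : ℚ))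
  haveI : (Cd • W.quadraticTwist (NumberField.discr K : ℚ)).IsGloballyMinimal := hCd
  -- the two shapes at the CM point (typed input)
  obtain ⟨P, hGZSh, hUSh⟩ := hSh W p K S (Cd • W.quadraticTwist (NumberField.discr K : ℚ)) Cd hX hp5
    hK hSeven hSin hsplit hFC rfl hLt
  haveI := hℓ₀F
  exact missingUpperBoundAt_of_classX11b_of_shimuraShapes_inertSet' hSk hGZK hmod W p hX hp5 hℓ₀p
    hmult₀ hram₀ K h2 S hpS hSin hsplit hFC hLt (Cd • W.quadraticTwist (NumberField.discr K : ℚ)) Cd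
    rfl P hGZSh hUSh

/-! ### The whole-class theorem with (T2) split into (T2α′) and (T2♯) -/

/-- **X11b, whole class, `p ≥ 5`: (T2) replaced by (T2α′) + (T2♯).** `BSD(E,p)` for EVERY X11b
pair with `p ≥ 5` from the published facts of gen 8's `bsdp_of_classX11b_five_of_typedInputs_local`
(+ `hFH`, the Friedberg–Hoffstein special case of JSW §7.4.2, a named fact) and the typed inputs (T1)
STEP L on the surjective pairs; **(T2α′)** the Euler-system half `Typed.MissingUpperBoundAt` on the
pairs with `p ∣ ∏c_ℓ` that have NO (ram) prime or are split-and-peu-ramifié at `p` (census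
2 132 + 20 824 of the 64 130 pairs with `p ∣ ∏c`); **(T2♯)** the two Shimura-curve displays at every
JSW field (41 174 pairs — see `missingUpperBoundAt_of_classX11b_of_ram_of_not_alpha`); (T3) X11a's
lower half; (T4′) the non-surjective corner localised. CONDITIONAL; nothing booked; X11b stays
CONSTRUCTION-SHAPED. [cite: JetchevSkinnerWan2017, §7.4.1–7.4.2 (pp. 30–31), Thm. 4.4.1 (p. 19)]
[cite: FriedbergHoffstein1995, Thm. B] [cite: Skinner2016PacificMC, Thm. C (§1) and footnote 1]
[cite: Wuthrich2014, Prop. 21 (p. 400)] [cite: SilvermanATAEC1994, V.6 Prop. 6.1 (p. 410)]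
[cite: BalakrishnanEtAl2019, §1 Thm. 1.2 (arXiv:1711.05846 p. 2)] [cite: Miller2011LMS, Def. 1.1] -/
theorem bsdp_of_classX11b_five_of_typedInputs_shimura
    -- published inputs (named facts of the tree)
    (hGZ : ∀ (N : ℕ) [NeZero N] (W : WeierstrassCurve ℚ) (K : Type) [Field K] [NumberField K],
      gross_zagier N W K)
    (hKo : ∀ (N : ℕ) [NeZero N] (W : WeierstrassCurve ℚ) (K : Type) [Field K] [NumberField K],
      kolyvagin N W K)
    (hB : ∀ (N : ℕ) [NeZero N] (W : WeierstrassCurve ℚ) (K : Type) [Field K] [NumberField K],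
      Kolyvagin1990_padicValNat_card_sha_le N W K)
    (hSk : Skinner2016.thmC_padicValRat_bsd_rank_zero) (hWu : sha_dvd_analyticSha)
    (hGZK : rank_eq_analyticRank_of_analyticRank_le_one) (hmod : hasEntireLFunction_rat)
    (hnf : exists_isNewformOf) (hHL : HoffsteinLuo1997_exists_twist_L_one_ne_zero)
    (hFHs : friedbergHoffstein_exists_heegnerField_split_twist_ne_zero)
    (hMaz : mazur_not_dvd_maninConstant_of_odd) (hNS : integral_neronScaling_of_isGloballyMinimal)
    (hBDMTV : thm12_not_le_normalizer_splitCartan)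
    -- Friedberg–Hoffstein 1995 Thm. B, the special case of JSW §7.4.2 (named fact of the tree)
    (hFH : friedbergHoffstein_exists_twist_ne_zero_inertAt)
    -- (T1) the typed input of the route (STEP L), at the odd-`d_K` Heegner data of surjective X11b pairs
    (hL : ∀ (W : WeierstrassCurve ℚ) [W.IsElliptic] [W.IsGloballyMinimal] (p : ℕ) [Fact p.Prime]
      (N : ℕ) [NeZero N] (K : Type) [Field K] [NumberField K]
      (Dt : ModularParametrizationData W N) (H : HeegnerDatum N (NumberField.discr K)) (ι : K →+* ℂ)
      (P : (W.baseChange K).toAffine.Point),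
      ClassX11b W p → Surj W p → W.conductorNorm ℤ = N → IsImaginaryQuadratic K →
      Odd (NumberField.discr K) → ¬ (p : ℤ) ∣ NumberField.discr K → ¬ p ∣ Units.torsionOrder K →
      SatisfiesHeegnerHypothesis N K →
      (W.quadraticTwist (NumberField.discr K : ℚ)).entireLFunction 1 ≠ 0 →
      WeierstrassCurve.Affine.Point.map ι.toRatAlgHom P = heegnerPointComplex Dt H →
      ¬ (p : ℤ) ∣ Dt.c → IndexLowerBoundAt W p K P)
    -- (T2α′) the Euler-system half on the pairs with `p ∣ ∏c` and (no (ram) prime, or shape (T2α))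
    (hUα : ∀ (W : WeierstrassCurve ℚ) [W.IsElliptic] [W.IsGloballyMinimal] (p : ℕ) [Fact p.Prime],
      ClassX11b W p → 5 ≤ p → p ∣ W.tamagawaProduct →
      (¬ Ram W p ∨ (W.HasSplitMultiplicativeReductionAtPrime p ∧
        p ∣ padicValInt p W.minimalDiscriminantInt)) → Typed.MissingUpperBoundAt W p)
    -- (T2♯) the two Shimura-curve shapes at every JSW field
    (hSh : ∀ (W : WeierstrassCurve ℚ) [W.IsElliptic] [W.IsGloballyMinimal] (p : ℕ) [Fact p.Prime]
      (K : Type) [Field K] [NumberField K] (S : Finset ℕ)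
      (Wd : WeierstrassCurve ℚ) [Wd.IsElliptic] [Wd.IsGloballyMinimal] (Cd : VariableChange ℚ),
      ClassX11b W p → 5 ≤ p → IsImaginaryQuadratic K → Even S.card →
      (∀ ℓ ∈ S, ∃ _ : Fact ℓ.Prime, Mult W ℓ ∧
        ((ℓ ≠ 2 ∧ jacobiSym (NumberField.discr K) ℓ = -1) ∨ (ℓ = 2 ∧ NumberField.discr K % 8 = 5))) →
      (∀ (ℓ : ℕ) [Fact ℓ.Prime], ¬ W.HasGoodReductionAtPrime ℓ → ℓ ∉ S →
        IsSquare (algebraMap ℚ ℚ_[ℓ] (NumberField.discr K : ℚ))) →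
      (∀ (ℓ : ℕ) [Fact ℓ.Prime], ℓ ∉ S → W.HasSplitMultiplicativeReductionAtPrime ℓ →
        ¬ p ∣ padicValInt ℓ W.minimalDiscriminantInt) →
      Cd • W.quadraticTwist (NumberField.discr K : ℚ) = Wd →
      (W.quadraticTwist (NumberField.discr K : ℚ)).entireLFunction 1 ≠ 0 →
      ∃ P : (W.baseChange K).toAffine.Point,
        (∃ qE qd : ℚ, qE ≠ 0 ∧ qd ≠ 0 ∧
          W.leadingLCoeff / ((W.realPeriodRat : ℂ) * (W.regulator : ℂ)) = (qE : ℂ) ∧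
          Wd.entireLFunction 1 / (Wd.realPeriodRat : ℂ) = (qd : ℂ) ∧
          (2 * padicValNat p (AddSubgroup.zmultiples P).index : ℤ) +
              (∑ ℓ ∈ S, padicValNat p (padicValInt ℓ W.minimalDiscriminantInt) : ℕ) =
            padicValRat p qE + padicValRat p qd) ∧
        Nat.card (AddCommGroup.primaryComponent (W.baseChange K).sha p) ≤
          p ^ (2 * padicValNat p (AddSubgroup.zmultiples P).index))
    -- (T3) the main-conjecture half on the rank-0 sister class X11a
    (hX11a : ∀ (Wd : WeierstrassCurve ℚ) [Wd.IsElliptic] [Wd.IsGloballyMinimal] (p : ℕ)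
      [Fact p.Prime], ClassX11a Wd p → Typed.MissingLowerBoundAt Wd p)
    -- (T4′) the non-surjective corner, LOCALISED: `p ∈ {5,7}`, `p ∣ ord_p Δ_min`, no (ram) prime
    (hC : ∀ (W : WeierstrassCurve ℚ) [W.IsElliptic] [W.IsGloballyMinimal] (p : ℕ) [Fact p.Prime],
      ClassX11b W p → ¬ Surj W p → (p = 5 ∨ p = 7) →
        p ∣ padicValInt p W.minimalDiscriminantInt → ¬ Ram W p → Typed.MissingPPartAt W p) :
    ∀ (W : WeierstrassCurve ℚ) [W.IsElliptic] [W.IsGloballyMinimal] (p : ℕ) [Fact p.Prime],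
      ClassX11b W p → 5 ≤ p → BSDp W p := by
  refine bsdp_of_classX11b_five_of_typedInputs_local hGZ hKo hB hSk hWu hGZK hmod hnf hHL hFHs hMaz
    hNS hBDMTV hL ?_ hX11a hC
  intro W _ _ p _ hX hp5 ht
  by_cases hram : Ram W p
  · by_cases hα : W.HasSplitMultiplicativeReductionAtPrime p ∧ p ∣ padicValInt p W.minimalDiscriminantInt
    · exact hUα W p hX hp5 ht (Or.inr hα)
    · exact missingUpperBoundAt_of_classX11b_of_ram_of_not_alpha hSk hGZK hmod hnf hFH hSh W p hX hp5
        hram hα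
  · exact hUα W p hX hp5 ht (Or.inl hram)

end Summit.BirchSwinnertonDyer.Rank1Residual.X11b

end
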